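import Mathlib.Data.Int.LeastGreatest
import Literature.NumberTheory.Automorphic.AdeleAddCharUnramified
import Literature.NumberTheory.GaloisRepresentations.LocalFieldProofs
import Literature.NumberTheory.Automorphic.AdditiveCharacterDuality
import HarnessLib

/-!
# Conductor exponents of additive characters: existence, uniqueness, dilation; a global
additive character unramified at any prescribed finite place

Topic `NumberTheory/Automorphic`; namespace `Literature.NumberTheory.Automorphic` (and three lemmas in
Mathlib's `AddChar` namespace for dot-notation, as in `TateLocalFactors`). Proof file (theorems
only: no definition, no named fact, no instance) on top of `TateLocalFactors` (the predicate
`AddChar.HasConductorExp ψ m`: `ψ` is trivial on `𝔭^m = primePowBall F m = {x | ‖x‖_F ≤ q^{-m}}`, not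
on `𝔭^{m-1}` — Tate (1950) §2.2; Bushnell–Henniart (2006), §1.7, "level"), `AdditiveCharacterDuality`
(a continuous additive character of a non-archimedean local field is trivial near `0`,
`AddCharDuality.exists_forall_lt_apply_eq_one`) and `GlobalAdditiveCharacter` (local components
`ψ_v = ψ.adicComponent v` of characters of `𝔸_K`; `IsGlobalAddChar.mulShift`: with `ψ`, every dilate
`x ↦ ψ(a x)`, `a ∈ Kˣ`, is a global additive character).

## Main statements (all proved)

Let `F` be a non-archimedean local field (Mathlib `IsNonarchimedeanLocalField`), `q = q_F`.

* `normAbs_le_normAbs_iff`, `normAbs_add_le_max`, `exists_normAbs_eq_zpow`,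
  `exists_normAbs_eq_inv_zpow` — bookkeeping for the normalised absolute value `‖·‖_F`
  (`normAbs`, values `q^ℤ ∪ {0}`); `primePowBall_antitone`, `add_mem_primePowBall`,
  `mul_mem_primePowBall_iff` (`a x ∈ 𝔭^m ↔ x ∈ 𝔭^{m-k}` for `‖a‖ = q^{-k}`),
  `exists_mem_primePowBall` (`F = ⋃_m 𝔭^m`), `primePowBall_mem_nhds_zero`.
* `AddChar.HasConductorExp.unique` — **the conductor exponent is unique**.
* `AddChar.IsContinuousNontrivial.exists_hasConductorExp` — **every non-trivial continuous additive
  character has a conductor exponent** (Bushnell–Henniart §1.7: "the least integer `d` such that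
  `𝔭^d ⊆ Ker ψ`"): the set of `m` with `ψ|_{𝔭^m} = 1` is non-empty (no small subgroups: `ψ` is
  trivial on a ball), upward closed, and not all of `ℤ` (`ψ ≠ 1`, `F = ⋃ 𝔭^m`); its least element is
  the conductor exponent.
* `AddChar.HasConductorExp.mulShift` — **dilation**: if `ψ` has conductor exponent `m` and
  `‖a‖_F = q^{-k}` then `x ↦ ψ(a x)` (`AddChar.mulShift ψ a`) has conductor exponent `m - k`
  (Bushnell–Henniart §1.7, Proposition: for `a ≠ 0` the character `aψ : x ↦ ψ(ax)` has level `d - υ_F(a)`); hence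
  `AddChar.IsContinuousNontrivial.exists_mulShift_hasConductorExp_zero`: some dilate has conductor
  exponent `0`.
* For the completion `K_v` of a number field: `valuation_le_valuation_iff_valued` (Mathlib's two
  valuations of `K_v` are compatible), `normAbs_eq_inv_zpow_of_valued_eq` (`|x|_v = exp n ⟹
  ‖x‖ = q_v^{n}`), `mem_primePowBall_adicCompletion_iff` — **`x ∈ 𝔭^m ↔ |x|_v ≤ exp (-m)`**, the
  dictionary between `primePowBall` and Mathlib's `Valued.v`;
  `adicComponent_mulShift_algebraMap` (`(aψ)_v = a ψ_v` for `a ∈ K`).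
* `IsGlobalAddChar.exists_mulShift_adicComponent_hasConductorExp_zero`,
  `IsGlobalAddChar.exists_isGlobalAddChar_hasConductorExp_zero` — **if `ψ_v ≠ 1`, some dilate
  `x ↦ ψ(a x)`, `a ∈ Kˣ`, has component of conductor exponent `0` at `v`**; with the components of
  Tate's character `adeleAddChar K` non-trivial at *every* finite place
  (`adicComponent_adeleAddChar_ne_one` of `GlobalAdditiveCharacterProofs`, Tate's Lemma 2.2.2), this
  gives for every finite place `v` of a number field a global additive character unramified at `v` —
  the normalisation "`ψ_v` of conductor `𝒪_v`" of the unramified local computations (Shintani's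
  formula, `WhittakerCoeffCuspidal`) made available at *any* single prescribed place, as needed for
  the pointwise part of `summable_normSq_trace_satakePow` (`SummableNormSqTraceSatakePowTorus`).

## References

* C. J. Bushnell, G. Henniart, *The local Langlands conjecture for GL(2)*, Grundlehren 335 (2006),
  §1.7 (Definition: level of a character of `F`; Proposition: `aψ` has level `d - υ_F(a)`), §1.1
  [BushnellHenniart2006].
* J. Tate, *Fourier analysis in number fields and Hecke's zeta-functions* (1950), in Cassels–Fröhlich
  (1967), Ch. XV, §2.2 and Thm. 4.1.4 [Tate1950] [CasselsFrohlichANT1967].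
-/

noncomputable section

namespace Literature.NumberTheory.Automorphic

open scoped NNReal WithZero
open ValuativeRel Filter Topology
open Literature.NumberTheory.GaloisRepresentations.IsNonarchimedeanLocalField

/-! ### The normalised absolute value and the balls `𝔭^m` -/

section Local

variable {F : Type*} [Field F] [ValuativeRel F] [TopologicalSpace F] [IsNonarchimedeanLocalField F]

/-- `1 < q_F` in `ℝ≥0`. [folklore] -/
theorem one_lt_residueFieldCard_nnreal : (1 : ℝ≥0) < (residueFieldCard F : ℝ≥0) := by
  exact_mod_cast one_lt_residueFieldCard F

/-- `0 < q_F⁻¹` in `ℝ≥0`. [folklore] -/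
theorem inv_residueFieldCard_pos : (0 : ℝ≥0) < (residueFieldCard F : ℝ≥0)⁻¹ :=
  inv_pos.2 (zero_lt_one.trans one_lt_residueFieldCard_nnreal)

/-- `q_F⁻¹ < 1` in `ℝ≥0`. [folklore] -/
theorem inv_residueFieldCard_lt_one : (residueFieldCard F : ℝ≥0)⁻¹ < 1 :=
  inv_lt_one_of_one_lt₀ one_lt_residueFieldCard_nnreal

/-- **`‖x‖_F ≤ ‖y‖_F ↔ v(x) ≤ v(y)`**: the normalised absolute value is an increasing function of the
valuation (`WithZeroMulInt.toNNReal` with base `q_F > 1` is strictly monotone). [folklore] -/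
theorem normAbs_le_normAbs_iff {x y : F} : normAbs F x ≤ normAbs F y ↔ valuation F x ≤ valuation F y := by
  rw [normAbs_apply, normAbs_apply,
    (WithZeroMulInt.toNNReal_strictMono one_lt_residueFieldCard_nnreal).le_iff_le]
  exact map_le_map_iff _

/-- `‖x‖_F < ‖y‖_F ↔ v(x) < v(y)`. [folklore] -/
theorem normAbs_lt_normAbs_iff {x y : F} : normAbs F x < normAbs F y ↔ valuation F x < valuation F y := by
  rw [normAbs_apply, normAbs_apply,
    (WithZeroMulInt.toNNReal_strictMono one_lt_residueFieldCard_nnreal).lt_iff_lt]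
  exact map_lt_map_iff _

/-- The normalised absolute value is non-archimedean: `‖x + y‖_F ≤ max ‖x‖_F ‖y‖_F`. [folklore] -/
theorem normAbs_add_le_max (x y : F) : normAbs F (x + y) ≤ max (normAbs F x) (normAbs F y) := by
  rcases le_total (valuation F x) (valuation F y) with h | h
  · refine le_trans ?_ (le_max_right _ _)
    exact normAbs_le_normAbs_iff.2 ((Valuation.map_add _ x y).trans (max_le h le_rfl))
  · refine le_trans ?_ (le_max_left _ _)
    exact normAbs_le_normAbs_iff.2 ((Valuation.map_add _ x y).trans (max_le le_rfl h))

/-- `‖-x‖_F = ‖x‖_F`. [folklore] -/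
theorem normAbs_neg (x : F) : normAbs F (-x) = normAbs F x := by
  rw [normAbs_apply, normAbs_apply, Valuation.map_neg]

/-- **`‖x‖_F ∈ q^ℤ` for `x ≠ 0`**: `‖x‖_F = (q⁻¹)^k` for some `k ∈ ℤ`. [folklore] -/
theorem exists_normAbs_eq_inv_zpow {x : F} (hx : x ≠ 0) :
    ∃ k : ℤ, normAbs F x = (residueFieldCard F : ℝ≥0)⁻¹ ^ k := by
  have hne : _root_.IsNonarchimedeanLocalField.valueGroupWithZeroIsoInt F (valuation F x) ≠ 0 := by
    intro h
    rw [← map_zero (_root_.IsNonarchimedeanLocalField.valueGroupWithZeroIsoInt F)] at h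
    exact hx ((map_eq_zero (valuation F)).mp
      ((_root_.IsNonarchimedeanLocalField.valueGroupWithZeroIsoInt F).injective h))
  refine ⟨-(WithZero.unzero hne).toAdd, ?_⟩
  rw [normAbs_apply, WithZeroMulInt.toNNReal_neg_apply _ hne, inv_zpow', neg_neg]

/-- **Every value `(q⁻¹)^m`, `m ∈ ℤ`, is attained**: `‖ϖ^m‖_F = (q⁻¹)^m` for a uniformizer `ϖ`
(`‖ϖ‖_F = q⁻¹`, `normAbs_uniformizer_holds`). [folklore] -/
theorem exists_normAbs_eq_inv_zpow_of_int (m : ℤ) :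
    ∃ a : F, a ≠ 0 ∧ normAbs F a = (residueFieldCard F : ℝ≥0)⁻¹ ^ m := by
  obtain ⟨ϖ, hϖ⟩ := Valuation.exists_isUniformizer_of_isCyclic_of_nontrivial (valuation F)
  have hnorm : normAbs F (ϖ : F) = (residueFieldCard F : ℝ≥0)⁻¹ := normAbs_uniformizer_holds hϖ
  have hϖ0 : (ϖ : F) ≠ 0 := by
    intro h
    rw [h, map_zero] at hnorm
    exact inv_residueFieldCard_pos.ne hnorm
  exact ⟨(ϖ : F) ^ m, zpow_ne_zero m hϖ0, by rw [map_zpow₀, hnorm]⟩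

/-- Membership in `𝔭^m` (definitional unfolding of `primePowBall`). [folklore] -/
theorem mem_primePowBall_iff {m : ℤ} {x : F} :
    x ∈ primePowBall F m ↔ normAbs F x ≤ (residueFieldCard F : ℝ≥0)⁻¹ ^ m :=
  Iff.rfl

/-- `0 ∈ 𝔭^m`. [folklore] -/
theorem zero_mem_primePowBall (m : ℤ) : (0 : F) ∈ primePowBall F m := by
  rw [mem_primePowBall_iff, map_zero]
  exact zero_le

/-- **The balls decrease**: `𝔭^{m'} ⊆ 𝔭^m` for `m ≤ m'` (`q⁻¹ ≤ 1`). [folklore] -/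
theorem primePowBall_antitone {m m' : ℤ} (h : m ≤ m') : primePowBall F m' ⊆ primePowBall F m :=
  fun _ hx => hx.trans (zpow_le_zpow_right_of_le_one₀ inv_residueFieldCard_pos
    inv_residueFieldCard_lt_one.le h)

/-- `𝔭^m` is closed under addition (ultrametric inequality). [folklore] -/
theorem add_mem_primePowBall {m : ℤ} {x y : F} (hx : x ∈ primePowBall F m)
    (hy : y ∈ primePowBall F m) : x + y ∈ primePowBall F m :=
  (normAbs_add_le_max x y).trans (max_le hx hy)

/-- `𝔭^m` is closed under negation. [folklore] -/
theorem neg_mem_primePowBall {m : ℤ} {x : F} (hx : x ∈ primePowBall F m) : -x ∈ primePowBall F m := by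
  rw [mem_primePowBall_iff, normAbs_neg]
  exact hx

/-- **Dilating a ball**: if `‖a‖_F = (q⁻¹)^k` then `a x ∈ 𝔭^m ↔ x ∈ 𝔭^{m-k}`. [folklore] -/
theorem mul_mem_primePowBall_iff {a : F} {k : ℤ} (ha : normAbs F a = (residueFieldCard F : ℝ≥0)⁻¹ ^ k)
    {m : ℤ} {x : F} : a * x ∈ primePowBall F m ↔ x ∈ primePowBall F (m - k) := by
  have h0 : (residueFieldCard F : ℝ≥0)⁻¹ ≠ 0 := inv_residueFieldCard_pos.ne'
  rw [mem_primePowBall_iff, mem_primePowBall_iff, map_mul, ha, zpow_sub₀ h0,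
    le_div_iff₀ (zpow_pos inv_residueFieldCard_pos k), mul_comm]

/-- **`F = ⋃_m 𝔭^m`**: every element lies in some ball. [folklore] -/
theorem exists_mem_primePowBall (x : F) : ∃ m : ℤ, x ∈ primePowBall F m := by
  by_cases hx : x = 0
  · exact ⟨0, hx ▸ zero_mem_primePowBall 0⟩
  · obtain ⟨k, hk⟩ := exists_normAbs_eq_inv_zpow hx
    exact ⟨k, le_of_eq hk⟩

/-- **Each `𝔭^m` is a neighbourhood of `0`** (it contains the open ball `{x | v(x) < v(a)}` for any
`a ≠ 0` with `‖a‖_F = (q⁻¹)^m`). [folklore] -/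
theorem primePowBall_mem_nhds_zero (m : ℤ) : primePowBall F m ∈ 𝓝 (0 : F) := by
  obtain ⟨a, ha0, ha⟩ := exists_normAbs_eq_inv_zpow_of_int (F := F) m
  rw [IsValuativeTopology.mem_nhds_zero_iff]
  refine ⟨Units.mk0 (valuation F a) ((map_ne_zero _).2 ha0), fun x hx => ?_⟩
  rw [Set.mem_setOf_eq, Units.val_mk0, ← normAbs_lt_normAbs_iff, ha] at hx
  exact hx.le

/-! ### Conductor exponents -/

/-- **The conductor exponent is unique.** [folklore] -/
theorem _root_.AddChar.HasConductorExp.unique {ψ : AddChar F Circle} {m m' : ℤ}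
    (h : ψ.HasConductorExp m) (h' : ψ.HasConductorExp m') : m = m' := by
  have key : ∀ {a b : ℤ}, ψ.HasConductorExp a → ψ.HasConductorExp b → b ≤ a := by
    intro a b ha hb
    obtain ⟨x, hx, hne⟩ := hb.2
    by_contra hlt
    exact hne (ha.1 x (primePowBall_antitone (by omega) hx))
  exact le_antisymm (key h' h) (key h h')

/-- **Existence of the conductor exponent** (Bushnell–Henniart §1.7, Definition: the level of a
non-trivial continuous `ψ` is the least `d` with `𝔭^d ⊆ Ker ψ`): a non-trivial continuous additive
character of `F` is trivial on some `𝔭^m` (no small subgroups,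
`AddCharDuality.exists_forall_lt_apply_eq_one`) and not on all of them (`F = ⋃ 𝔭^m`), and the set of
such `m` is upward closed; its least element `d` has `ψ|_{𝔭^d} = 1 ≠ ψ|_{𝔭^{d-1}}`.
[cite: BushnellHenniart2006, §1.7, Definition] -/
theorem _root_.AddChar.IsContinuousNontrivial.exists_hasConductorExp {ψ : AddChar F Circle}
    (hψ : ψ.IsContinuousNontrivial) : ∃ m : ℤ, ψ.HasConductorExp m := by
  -- `ψ` is trivial on some ball
  obtain ⟨γ, hγ⟩ := AddCharDuality.exists_forall_lt_apply_eq_one hψ.1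
  obtain ⟨g, hg⟩ := ValuativeRel.valuation_surjective (γ : ValueGroupWithZero F)
  have hg0 : g ≠ 0 := by
    rintro rfl
    exact γ.ne_zero (by simpa using hg.symm)
  obtain ⟨k, hk⟩ := exists_normAbs_eq_inv_zpow hg0
  have hP : ∀ x ∈ primePowBall F (k + 1), ψ x = 1 := by
    intro x hx
    refine hγ x ?_
    rw [← hg, ← normAbs_lt_normAbs_iff, hk]
    exact lt_of_le_of_lt hx (zpow_lt_zpow_right_of_lt_one₀ inv_residueFieldCard_pos
      inv_residueFieldCard_lt_one (lt_add_one k))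
  -- and non-trivial somewhere, hence on all small enough `m`
  obtain ⟨x₀, hx₀⟩ := AddChar.ne_zero_iff.1 hψ.2
  obtain ⟨m₁, hm₁⟩ := exists_mem_primePowBall x₀
  have hbdd : ∀ z : ℤ, (∀ x ∈ primePowBall F z, ψ x = 1) → m₁ + 1 ≤ z := by
    intro z hz
    by_contra hle
    exact hx₀ (hz x₀ (primePowBall_antitone (by omega) hm₁))
  obtain ⟨d, hd, hmin⟩ :=
    Int.exists_least_of_bdd (P := fun z => ∀ x ∈ primePowBall F z, ψ x = 1) ⟨m₁ + 1, hbdd⟩ ⟨k + 1, hP⟩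
  refine ⟨d, hd, ?_⟩
  by_contra hno
  push Not at hno
  have := hmin (d - 1) hno
  omega

/-- **Dilation** (Bushnell–Henniart §1.7, Proposition: "`aψ` has level `d - υ_F(a)`" for `a ≠ 0`): if `ψ` has
conductor exponent `m` and `‖a‖_F = (q⁻¹)^k` (i.e. `υ_F(a) = k`), then `x ↦ ψ(a x)` has conductor
exponent `m - k`. [cite: BushnellHenniart2006, §1.7, Proposition] -/
theorem _root_.AddChar.HasConductorExp.mulShift {ψ : AddChar F Circle} {m : ℤ}
    (h : ψ.HasConductorExp m) {a : F} {k : ℤ}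
    (ha : normAbs F a = (residueFieldCard F : ℝ≥0)⁻¹ ^ k) :
    (ψ.mulShift a).HasConductorExp (m - k) := by
  have ha0 : a ≠ 0 := by
    intro h0
    rw [h0, map_zero] at ha
    exact (zpow_ne_zero k inv_residueFieldCard_pos.ne') ha.symm
  refine ⟨fun x hx => ?_, ?_⟩
  · rw [AddChar.mulShift_apply]
    exact h.1 _ ((mul_mem_primePowBall_iff ha).2 hx)
  · obtain ⟨y, hy, hne⟩ := h.2
    refine ⟨a⁻¹ * y, ?_, by rwa [AddChar.mulShift_apply, mul_inv_cancel_left₀ ha0]⟩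
    rw [show m - k - 1 = m - 1 - k by ring, ← mul_mem_primePowBall_iff ha,
      mul_inv_cancel_left₀ ha0]
    exact hy

/-- Dilation by a unit does not change the conductor exponent. [folklore] -/
theorem _root_.AddChar.HasConductorExp.mulShift_of_normAbs_eq_one {ψ : AddChar F Circle} {m : ℤ}
    (h : ψ.HasConductorExp m) {u : F} (hu : normAbs F u = 1) : (ψ.mulShift u).HasConductorExp m := by
  simpa using h.mulShift (k := 0) (by rw [zpow_zero]; exact hu)

/-- **Normalising the conductor**: if `ψ` has conductor exponent `m` and `‖a‖_F = (q⁻¹)^m` then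
`x ↦ ψ(a x)` has conductor exponent `0`. [cite: BushnellHenniart2006, §1.7, Proposition] -/
theorem _root_.AddChar.HasConductorExp.mulShift_hasConductorExp_zero {ψ : AddChar F Circle} {m : ℤ}
    (h : ψ.HasConductorExp m) {a : F} (ha : normAbs F a = (residueFieldCard F : ℝ≥0)⁻¹ ^ m) :
    (ψ.mulShift a).HasConductorExp 0 := by
  simpa using h.mulShift ha

/-- **Every non-trivial continuous additive character has a dilate of conductor exponent `0`**
(`x ↦ ψ(ϖ^d x)`, `d` the conductor exponent). [cite: BushnellHenniart2006, §1.7] -/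
theorem _root_.AddChar.IsContinuousNontrivial.exists_mulShift_hasConductorExp_zero
    {ψ : AddChar F Circle} (hψ : ψ.IsContinuousNontrivial) :
    ∃ a : F, a ≠ 0 ∧ (ψ.mulShift a).HasConductorExp 0 := by
  obtain ⟨m, hm⟩ := hψ.exists_hasConductorExp
  obtain ⟨a, ha0, ha⟩ := exists_normAbs_eq_inv_zpow_of_int (F := F) m
  exact ⟨a, ha0, hm.mulShift_hasConductorExp_zero ha⟩

end Local

/-! ### The completion `K_v`: `primePowBall` versus Mathlib's `Valued.v` -/

section Completion

open NumberField IsDedekindDomain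

variable {K : Type} [Field K] [NumberField K] (v : HeightOneSpectrum (𝓞 K))

/-- A global `v`-adic uniformizer: `π ∈ K` with `|π|_v = exp (-1)` in `K_v` (Mathlib
`valuation_exists_uniformizer`). [folklore] -/
theorem exists_coe_valued_eq_exp_neg_one :
    ∃ π : K, π ≠ 0 ∧ Valued.v (π : v.adicCompletion K) = WithZero.exp (-1 : ℤ) := by
  obtain ⟨π, hπ⟩ := v.valuation_exists_uniformizer K
  have hπ0 : π ≠ 0 := by
    intro h
    rw [h, map_zero] at hπ
    exact WithZero.exp_ne_zero hπ.symm
  exact ⟨π, hπ0, by rw [HeightOneSpectrum.valuedAdicCompletion_eq_valuation', hπ]⟩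

/-- **Mathlib's two valuations of `K_v` are compatible**: `valuation K_v x ≤ valuation K_v y ↔
|x|_v ≤ |y|_v` (both are compatible with the valuative relation of `K_v`, which is *defined* from
`Valued.v`, `AdicCompletionLocalField`). [folklore] -/
theorem valuation_le_valuation_iff_valued (x y : v.adicCompletion K) :
    valuation (v.adicCompletion K) x ≤ valuation (v.adicCompletion K) y ↔ Valued.v x ≤ Valued.v y :=
  (Valuation.vle_iff_le (valuation (v.adicCompletion K))).symm.trans (Valuation.vle_iff_le Valued.v)

/-- `‖x‖ ≤ ‖y‖ ↔ |x|_v ≤ |y|_v` on `K_v`. [folklore] -/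
theorem normAbs_le_normAbs_iff_valued (x y : v.adicCompletion K) :
    normAbs (v.adicCompletion K) x ≤ normAbs (v.adicCompletion K) y ↔ Valued.v x ≤ Valued.v y :=
  normAbs_le_normAbs_iff.trans (valuation_le_valuation_iff_valued v x y)

/-- **`|ϖ|_v = exp (-1) ⟹ ‖ϖ‖ = q_v⁻¹`**: an element of `Valued.v`-valuation `exp (-1)` is a
uniformizing element (`isUniformizingElement_of_valued_eq`), so an element of norm exactly `q_v⁻¹`
(which exists, `exists_normAbs_eq_inv_zpow_of_int`) is a multiple of it by an integer, giving
`q_v⁻¹ ≤ ‖ϖ‖`; and `‖ϖ‖ < 1` forces `‖ϖ‖ ≤ q_v⁻¹`. [folklore] -/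
theorem normAbs_eq_inv_of_valued_eq_exp_neg_one {ϖ : v.adicCompletion K}
    (hϖ : Valued.v ϖ = WithZero.exp (-1 : ℤ)) :
    normAbs (v.adicCompletion K) ϖ = (residueFieldCard (v.adicCompletion K) : ℝ≥0)⁻¹ := by
  have hu := isUniformizingElement_of_valued_eq K v hϖ
  refine le_antisymm ?_ ?_
  · -- `‖ϖ‖ < 1`, and the values are `(q⁻¹)^k`
    have hlt : normAbs (v.adicCompletion K) ϖ < 1 := normAbs_lt_one_iff.2 hu.valuation_lt_one
    obtain ⟨k, hk⟩ := exists_normAbs_eq_inv_zpow hu.ne_zero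
    rw [hk] at hlt ⊢
    have hk1 : 1 ≤ k := by
      by_contra hk0
      push Not at hk0
      have : (1 : ℝ≥0) ≤ (residueFieldCard (v.adicCompletion K) : ℝ≥0)⁻¹ ^ k := by
        rw [← zpow_zero ((residueFieldCard (v.adicCompletion K) : ℝ≥0)⁻¹)]
        exact zpow_le_zpow_right_of_le_one₀ inv_residueFieldCard_pos
          inv_residueFieldCard_lt_one.le (by omega)
      exact absurd hlt (not_lt.2 this)
    calc (residueFieldCard (v.adicCompletion K) : ℝ≥0)⁻¹ ^ k
        ≤ (residueFieldCard (v.adicCompletion K) : ℝ≥0)⁻¹ ^ (1 : ℤ) :=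
          zpow_le_zpow_right_of_le_one₀ inv_residueFieldCard_pos inv_residueFieldCard_lt_one.le hk1
      _ = _ := zpow_one _
  · obtain ⟨x, -, hx⟩ := exists_normAbs_eq_inv_zpow_of_int (F := v.adicCompletion K) 1
    rw [zpow_one] at hx
    have hx1 : normAbs (v.adicCompletion K) x < 1 := hx ▸ inv_residueFieldCard_lt_one
    have hxO : x ∈ 𝒪[v.adicCompletion K] := normAbs_le_one_iff.1 hx1.le
    obtain ⟨y, hy, hxy⟩ := hu.exists_eq_mul hxO (normAbs_lt_one_iff.1 hx1)
    rw [← hx, hxy, map_mul]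
    calc normAbs (v.adicCompletion K) ϖ * normAbs (v.adicCompletion K) y
        ≤ normAbs (v.adicCompletion K) ϖ * 1 := mul_le_mul' le_rfl (normAbs_le_one_iff.2 hy)
      _ = _ := mul_one _

/-- **`|x|_v = exp n ⟹ ‖x‖ = (q_v⁻¹)^{-n}`** (compare with `ϖ^{-n}` for a uniformizer `ϖ`).
[folklore] -/
theorem normAbs_eq_inv_zpow_of_valued_eq {x : v.adicCompletion K} {n : ℤ}
    (hx : Valued.v x = WithZero.exp n) :
    normAbs (v.adicCompletion K) x = (residueFieldCard (v.adicCompletion K) : ℝ≥0)⁻¹ ^ (-n) := by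
  obtain ⟨π, -, hπ⟩ := exists_coe_valued_eq_exp_neg_one v
  have hϖn : Valued.v ((π : v.adicCompletion K) ^ (-n)) = WithZero.exp n := by
    rw [map_zpow₀, hπ, ← WithZero.exp_zsmul, smul_eq_mul, mul_neg_one, neg_neg]
  have heq : normAbs (v.adicCompletion K) x =
      normAbs (v.adicCompletion K) ((π : v.adicCompletion K) ^ (-n)) :=
    le_antisymm ((normAbs_le_normAbs_iff_valued v _ _).2 (by rw [hx, hϖn]))
      ((normAbs_le_normAbs_iff_valued v _ _).2 (by rw [hx, hϖn]))
  rw [heq, map_zpow₀, normAbs_eq_inv_of_valued_eq_exp_neg_one v hπ]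

/-- **The dictionary `𝔭^m = {x | |x|_v ≤ exp (-m)}`** between the balls `primePowBall K_v m` of
`TateLocalFactors` (normalised absolute value `‖x‖ ≤ q_v^{-m}`) and Mathlib's `Valued.v`.
[folklore] -/
theorem mem_primePowBall_adicCompletion_iff {m : ℤ} {x : v.adicCompletion K} :
    x ∈ primePowBall (v.adicCompletion K) m ↔ Valued.v x ≤ WithZero.exp (-m) := by
  obtain ⟨π, -, hπ⟩ := exists_coe_valued_eq_exp_neg_one v
  have hϖm : Valued.v ((π : v.adicCompletion K) ^ m) = WithZero.exp (-m) := by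
    rw [map_zpow₀, hπ, ← WithZero.exp_zsmul, smul_eq_mul, mul_neg_one]
  have hnorm : normAbs (v.adicCompletion K) ((π : v.adicCompletion K) ^ m) =
      (residueFieldCard (v.adicCompletion K) : ℝ≥0)⁻¹ ^ m := by
    rw [normAbs_eq_inv_zpow_of_valued_eq v hϖm, neg_neg]
  rw [mem_primePowBall_iff, ← hnorm, normAbs_le_normAbs_iff_valued, hϖm]

/-- The norm of a global element of prescribed valuation: if `v(a) = exp n` for `a ∈ K` then
`‖a‖ = (q_v⁻¹)^{-n}` in `K_v`. [folklore] -/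
theorem normAbs_coe_eq_inv_zpow {a : K} {n : ℤ} (ha : v.valuation K a = WithZero.exp n) :
    normAbs (v.adicCompletion K) (a : v.adicCompletion K) =
      (residueFieldCard (v.adicCompletion K) : ℝ≥0)⁻¹ ^ (-n) :=
  normAbs_eq_inv_zpow_of_valued_eq v (by rw [HeightOneSpectrum.valuedAdicCompletion_eq_valuation', ha])

/-! ### Global additive characters unramified at a prescribed place -/

/-- **`(aψ)_v = a ψ_v`**: the component at `v` of the dilate `x ↦ ψ(a x)` of a character `ψ` of `𝔸_K`
by a principal adele `a ∈ K` is the dilate by `a ∈ K_v` of the component `ψ_v`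
(`(a)_𝔸 · ι_v(x) = ι_v(a x)`). [folklore] -/
theorem adicComponent_mulShift_algebraMap (ψ : AddChar (AdeleRing (𝓞 K) K) Circle) (a : K) :
    (ψ.mulShift (algebraMap K (AdeleRing (𝓞 K) K) a)).adicComponent v =
      (ψ.adicComponent v).mulShift (a : v.adicCompletion K) := by
  classical
  refine AddChar.ext _ _ fun x => ?_
  rw [AddChar.adicComponent_apply, AddChar.mulShift_apply, AddChar.mulShift_apply,
    AddChar.adicComponent_apply]
  refine congrArg ψ (Prod.ext ?_ ?_)
  · change (algebraMap K (AdeleRing (𝓞 K) K) a).1 * (adeleSingleHom K v x).1 = (adeleSingleHom K v _).1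
    rw [adeleSingleHom_apply_fst, adeleSingleHom_apply_fst, mul_zero]
  · change (algebraMap K (AdeleRing (𝓞 K) K) a).2 * (adeleSingleHom K v x).2 = (adeleSingleHom K v _).2
    rw [adeleSingleHom_apply_snd, adeleSingleHom_apply_snd]
    refine FiniteAdeleRing.ext K fun w => ?_
    change (algebraMap K (AdeleRing (𝓞 K) K) a).2 w * finiteAdeleSingleHom K v x w =
      finiteAdeleSingleHom K v _ w
    by_cases hw : w = v
    · subst hw
      rw [finiteAdeleSingleHom_apply_self, finiteAdeleSingleHom_apply_self]
      rfl
    · rw [finiteAdeleSingleHom_apply_of_ne K v _ hw, finiteAdeleSingleHom_apply_of_ne K v _ hw,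
        mul_zero]

/-- **Normalising a global additive character at a prescribed place.** If the component `ψ_v` of a
global additive character `ψ` at the finite place `v` is non-trivial, then for some `a ∈ Kˣ` the
dilate `x ↦ ψ(a x)` has component of conductor exponent `0` at `v`: `ψ_v` is continuous and
non-trivial, so has a conductor exponent `d` (`exists_hasConductorExp`); with `π ∈ K` a `v`-adic
uniformizer (`valuation_exists_uniformizer`), `a = π^d` has `‖a‖ = q_v^{-d}` in `K_v` and
`(aψ)_v = a ψ_v` has conductor exponent `d - d = 0`. [cite: Tate1950, §2.2, Thm. 4.1.4] -/
theorem IsGlobalAddChar.exists_mulShift_adicComponent_hasConductorExp_zero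
    {ψ : AddChar (AdeleRing (𝓞 K) K) Circle} (hψ : IsGlobalAddChar K ψ) (hv : ψ.adicComponent v ≠ 1) :
    ∃ a : K, a ≠ 0 ∧
      ((ψ.mulShift (algebraMap K (AdeleRing (𝓞 K) K) a)).adicComponent v).HasConductorExp 0 := by
  obtain ⟨d, hd⟩ := (hψ.isContinuousNontrivial_adicComponent hv).exists_hasConductorExp
  obtain ⟨π, hπ⟩ := v.valuation_exists_uniformizer K
  have hπ0 : π ≠ 0 := by
    intro h
    rw [h, map_zero] at hπ
    exact WithZero.exp_ne_zero hπ.symm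
  refine ⟨π ^ d, zpow_ne_zero d hπ0, ?_⟩
  rw [adicComponent_mulShift_algebraMap]
  refine hd.mulShift_hasConductorExp_zero ?_
  have hval : v.valuation K (π ^ d) = WithZero.exp (-d) := by
    rw [map_zpow₀, hπ, ← WithZero.exp_zsmul, smul_eq_mul, mul_neg_one]
  rw [show ((π ^ d : K) : v.adicCompletion K) = (π ^ d : K) from rfl, normAbs_coe_eq_inv_zpow v hval,
    neg_neg]

/-- Hence, from any global additive character with non-trivial component at `v`, **a global additive
character whose component at `v` has conductor exponent `0`** (a dilate by an element of `Kˣ`,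
`IsGlobalAddChar.mulShift`). [cite: Tate1950, §2.2, Thm. 4.1.4] -/
theorem IsGlobalAddChar.exists_isGlobalAddChar_hasConductorExp_zero
    {ψ : AddChar (AdeleRing (𝓞 K) K) Circle} (hψ : IsGlobalAddChar K ψ) (hv : ψ.adicComponent v ≠ 1) :
    ∃ ψ' : AddChar (AdeleRing (𝓞 K) K) Circle, IsGlobalAddChar K ψ' ∧
      (ψ'.adicComponent v).HasConductorExp 0 := by
  obtain ⟨a, ha0, ha⟩ := hψ.exists_mulShift_adicComponent_hasConductorExp_zero v hv
  exact ⟨_, hψ.mulShift ha0, ha⟩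

end Completion

end Literature.NumberTheory.Automorphic
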